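import Summits.ABC.ABC.Theses.FeketeScales
import Summits.ABC.ABC.Theorems.FeketeScalesAssembly
import Summits.ABC.ABC.Theorems.FeketeScalesPolynomialAbcOfSubmult
import Summits.ABC.ABC.Theorems.FeketeScalesSparseGoodScalesUpperPropagation
import Summits.ABC.ABC.Theorems.FeketeScalesSparseGoodScalesWindow
import Literature.NumberTheory.DiophantineGeometry.AbcWave0SUnitProofs
import HarnessLib

/-!
# Route FeketeScales — crux `SparseGoodScales` (stmt-ABC-2161): the minimal in-route residue
# "droughts of SOME ratio" (DA∃) and the reduction `ScaleSubmultiplicativity → DA∃ → SparseGoodScales`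

Helper file (`--supports stmt-ABC-2161`) for the crux `SparseGoodScales` of route `FeketeScales`,
line `SketchIdeator4` of `Cruxes/SparseGoodScales/` (round-2 ideator 4's sorry-free package
`Cruxes/SparseGoodScales/SketchIdeator4.lean`, companion of `BarrierNotes-r2-k4.md` §2–§3), landed by
the line lead with all statements written INLINE in the tree's vocabulary (`IsABCTriple`, `rad`, the
route decls; no new definitions).  Notation used in the docstrings only:

* SGS = the crux `Summit.ABC.ABC.Theses.FeketeScales.SparseGoodScales`;
* 2160 = the sister crux `Summit.ABC.ABC.Theses.FeketeScales.ScaleSubmultiplicativity`;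
* DA∃ ("droughts of SOME ratio") = the sentence
  `∀ δ > 0, ∃ Λ > 1, ∀ N, ∃ R ≥ N, ∀ abc triples, rad ≤ R → R < rad^Λ → c ≤ rad^{1+δ}` —
  for every `δ` the radicals of the `(1+δ)`-exceptional triples omit, infinitely often, a window
  `(R^{1/Λ}, R]` of SOME fixed ratio `Λ(δ) > 1` (they are not log-log-dense);
* DA ("droughts of EVERY ratio") = the same with `∀ Λ > 1` (round 1's `RadicalLacunarity` /
  `ExceptionalRadicalDroughts`);
* WGS ("windowed good scales") = `∀ δ > 0, ∀ Λ > 1, ∀ N, ∃ R ≥ N, ∀ abc, rad ≤ R → R < rad^Λ →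
  c ≤ R^{1+δ}` (the horizontal stub of the dead line `Sketch`,
  `Theorems/FeketeScalesSparseGoodScalesWindow.lean`).

Results (all elementary real analysis over the landed Fekete machinery of
`Theorems/FeketeScalesAssembly.lean`):
* `droughtsOfSomeRatio_of_every`            : DA → DA∃ (`Λ := 2`);
* `droughtsOfSomeRatio_of_windowed`         : WGS → DA∃ (thin top windows, `Λ(δ) = (1+δ)/(1+δ/2)`);
* `droughtsOfSomeRatio_of_sparseGoodScales` : SGS → DA∃ (same thin windows);
* `flat_of_drought`    : at a drought scale the record is attained BELOW the window or is `≤ R^{1+δ}`;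
* `upper_propagation`  : the Fekete upgrade from ONE scale with ANY exponent `q` (normalised 2160):
  if every abc triple of radical `≤ S` has `c ≤ S^q` at one large scale `S`, then
  `c ≤ e^B · rad^{q+2δ}` for EVERY abc triple;
* `sparseGoodScales_of_scaleSubmultiplicativity_of_droughts` : **2160 → DA∃ → SGS** (the
  composition of line `SketchIdeator4`; abc.S25 enters through the PROVED
  `finite_setOf_isABCTriple_primeFactors_subset_holds`);
* `droughtsOfSomeRatio_iff_sparseGoodScales_of_scaleSubmultiplicativity` : 2160 → (DA∃ ↔ SGS);
* `droughtsOfSomeRatio_of_abc` : ABC → DA∃ (calibration: no refutation of the stub short of `¬ABC`);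
* `droughtsOfSomeRatio_iff_abc_of_scaleSubmultiplicativity` : 2160 → (DA∃ ↔ ABC) (in-route the
  horizontal stub of line `SketchIdeator4` is summit-equivalent, like every residue of this crux).

So DA∃ is the weakest statement in the tree that completes route FeketeScales (with the landed
`sparseGoodScales_iff_abc_of_scaleSubmultiplicativity`: under 2160, DA∃ ↔ SGS ↔ WGS ↔ ABC), and the
reduction uses 2160 at FULL strength (upper propagation from an arbitrary seed exponent), which the
round-1 factorisation through bounded quality cannot see.  What is NOT here: any proof of DA∃ or of
2160 (both open; `BarrierNotes-r2-k4.md` §1–§2: no gap principle across varying supports exists, the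
counting threshold for DA∃ is `O(log log X)` exceptional radicals below `X` against the proved
`X^{0.6+ε}`).
-/

-- `Summit.<Summit>.<Problem>` is the mandated summit-side namespace (CONVENTIONS §2); for the
-- single-conjunct summit `ABC` the two coincide, so the duplicate `ABC.ABC` is deliberate.
set_option linter.dupNamespace false

namespace Summit.ABC.ABC.Theorems.SparseGoodScales

open Literature.NumberTheory.DiophantineGeometry
open Summit.ABC.ABC.Theses.FeketeScales
open Summit.ABC.ABC.Theorems

/-- **DA → DA∃**: droughts of every ratio give droughts of some ratio (take `Λ := 2`). [folklore] -/
theorem droughtsOfSomeRatio_of_every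
    (h : ∀ δ : ℝ, 0 < δ → ∀ Λ : ℝ, 1 < Λ → ∀ N : ℕ, ∃ R : ℕ, N ≤ R ∧ ∀ a b c : ℕ,
      IsABCTriple a b c → rad a b c ≤ R → (R : ℝ) < ((rad a b c : ℕ) : ℝ) ^ Λ →
        (c : ℝ) ≤ ((rad a b c : ℕ) : ℝ) ^ (1 + δ)) :
    ∀ δ : ℝ, 0 < δ → ∃ Λ : ℝ, 1 < Λ ∧ ∀ N : ℕ, ∃ R : ℕ, N ≤ R ∧ ∀ a b c : ℕ,
      IsABCTriple a b c → rad a b c ≤ R → (R : ℝ) < ((rad a b c : ℕ) : ℝ) ^ Λ →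
        (c : ℝ) ≤ ((rad a b c : ℕ) : ℝ) ^ (1 + δ) :=
  fun δ hδ => ⟨2, one_lt_two, h δ hδ 2 one_lt_two⟩

/-- The thin-window computation: if `R < rad^Λ` with `Λ = (1+δ)/(1+δ/2)` then
`R^{1+δ/2} < rad^{1+δ}`. [folklore] -/
theorem rpow_window_lt {δ : ℝ} (hδ : 0 < δ) {R r : ℝ} (hR : 0 ≤ R) (hr : 0 ≤ r)
    (hw : R < r ^ ((1 + δ) / (1 + δ / 2))) :
    R ^ (1 + δ / 2) < r ^ (1 + δ) := by
  have h1 : 0 < 1 + δ / 2 := by linarith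
  have h2 : R ^ (1 + δ / 2) < (r ^ ((1 + δ) / (1 + δ / 2))) ^ (1 + δ / 2) :=
    Real.rpow_lt_rpow hR hw h1
  have h3 : (r ^ ((1 + δ) / (1 + δ / 2))) ^ (1 + δ / 2) = r ^ (1 + δ) := by
    rw [← Real.rpow_mul hr]
    congr 1
    field_simp
  rwa [h3] at h2

/-- The thin-window ratio `(1+δ)/(1+δ/2)` exceeds `1`. [folklore] -/
theorem one_lt_windowRatio {δ : ℝ} (hδ : 0 < δ) : 1 < (1 + δ) / (1 + δ / 2) := by
  rw [one_lt_div (by linarith)]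
  linarith

/-- **SGS → DA∃** (standalone): a `δ/2`-good scale of the crux is a drought scale for quality
`1+δ` on the THIN top window `(R^{(1+δ/2)/(1+δ)}, R]`, i.e. with `Λ(δ) = (1+δ)/(1+δ/2)`
(round 1's `radicalLacunarity_top_of_sparseGoodScales`, restated for DA∃). [folklore] -/
theorem droughtsOfSomeRatio_of_sparseGoodScales (h : SparseGoodScales) :
    ∀ δ : ℝ, 0 < δ → ∃ Λ : ℝ, 1 < Λ ∧ ∀ N : ℕ, ∃ R : ℕ, N ≤ R ∧ ∀ a b c : ℕ,
      IsABCTriple a b c → rad a b c ≤ R → (R : ℝ) < ((rad a b c : ℕ) : ℝ) ^ Λ →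
        (c : ℝ) ≤ ((rad a b c : ℕ) : ℝ) ^ (1 + δ) := by
  intro δ hδ
  refine ⟨(1 + δ) / (1 + δ / 2), one_lt_windowRatio hδ, fun N => ?_⟩
  obtain ⟨R, hNR, hR⟩ := h (δ / 2) (by linarith) N
  refine ⟨R, hNR, fun a b c habc hrad hwin => ?_⟩
  have hc : (c : ℝ) ≤ (R : ℝ) ^ (1 + δ / 2) := hR a b c habc hrad
  exact hc.trans (rpow_window_lt hδ (Nat.cast_nonneg R) (Nat.cast_nonneg _) hwin).le

/-- **WGS → DA∃** (standalone): WGS at `(δ/2, Λ(δ))` on the same thin window. [folklore] -/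
theorem droughtsOfSomeRatio_of_windowed
    (h : ∀ δ : ℝ, 0 < δ → ∀ Λ : ℝ, 1 < Λ → ∀ N : ℕ, ∃ R : ℕ, N ≤ R ∧ ∀ a b c : ℕ,
      IsABCTriple a b c → rad a b c ≤ R → (R : ℝ) < ((rad a b c : ℕ) : ℝ) ^ Λ →
        (c : ℝ) ≤ (R : ℝ) ^ (1 + δ)) :
    ∀ δ : ℝ, 0 < δ → ∃ Λ : ℝ, 1 < Λ ∧ ∀ N : ℕ, ∃ R : ℕ, N ≤ R ∧ ∀ a b c : ℕ,
      IsABCTriple a b c → rad a b c ≤ R → (R : ℝ) < ((rad a b c : ℕ) : ℝ) ^ Λ →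
        (c : ℝ) ≤ ((rad a b c : ℕ) : ℝ) ^ (1 + δ) := by
  intro δ hδ
  refine ⟨(1 + δ) / (1 + δ / 2), one_lt_windowRatio hδ, fun N => ?_⟩
  obtain ⟨R, hNR, hR⟩ := h (δ / 2) (by linarith) _ (one_lt_windowRatio hδ) N
  refine ⟨R, hNR, fun a b c habc hrad hwin => ?_⟩
  have hc : (c : ℝ) ≤ (R : ℝ) ^ (1 + δ / 2) := hR a b c habc hrad hwin
  exact hc.trans (rpow_window_lt hδ (Nat.cast_nonneg R) (Nat.cast_nonneg _) hwin).le

/-- **The reduction `ScaleSubmultiplicativity → DA∃ → SparseGoodScales`** (the composition of line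
`SketchIdeator4` of crux stmt-ABC-2161; DA∃ = droughts of SOME ratio, the second hypothesis, inline).

Proof (finitary, by contradiction, in the `G`-free currency `P S q := ∀ triples, rad ≤ S → c ≤ S^q`).
Normalise the crux (`submult_normalise`).  Suppose `¬ SGS`: some `ε > 0` and `N₀` such that every
scale `R ≥ N₀` carries a triple with `rad ≤ R`, `c > R^{1+ε}`.  Take DA∃ at `ε/2`:
a ratio `Λ > 1` and drought scales `R → ∞`.  Put `δ₁ := min (ε/12) ((Λ−1)/(4(Λ+2)))` and let `T`
be the threshold of `upper_propagation` for `δ₁`; call `(S, q)` ADMISSIBLE if `S ≥ R₀`,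
`log S ≥ T`, `q ≥ 0` and `P S q`.
STEP (`step`): from an admissible `(S, q)`, `upper_propagation` bounds every triple by
`e^B rad^{q+2δ₁}`; at a large drought scale `R` the triples BELOW the window have
`c ≤ e^B R^{(q+2δ₁)/Λ} ≤ R^{m₁}`, `m₁ := (q+2δ₁)/Λ + δ₁`, so by `flat_of_drought`
`P R (max m₁ (1+ε/2))`; but `R ≥ N₀` is `ε`-bad, which forces `m₁ > 1 + ε` — so `(R, m₁)` is
admissible, `m₁ > 1+ε`, and `q = Λ m₁ − (Λ+2) δ₁`.
ESCALATION (`key`, induction on `k`): every admissible `q` satisfies `q ≥ 1 + ε/2 + k (Λ−1)/2`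
for every `k` (the step gains `(Λ−1) m₁ − (Λ+2)δ₁ ≥ (Λ−1)/2` since `m₁ ≥ 1`).
But abc.S25 (`finite_setOf_isABCTriple_primeFactors_subset_holds`, PROVED in the tree) makes some
`(S*, M)` admissible with a FIXED finite exponent `M` — contradiction for `k > 2M/(Λ−1)`.
[folklore] -/
theorem sparseGoodScales_of_scaleSubmultiplicativity_of_droughts
    (hS : ScaleSubmultiplicativity)
    (hD : ∀ δ : ℝ, 0 < δ → ∃ Λ : ℝ, 1 < Λ ∧ ∀ N : ℕ, ∃ R : ℕ, N ≤ R ∧ ∀ a b c : ℕ,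
      IsABCTriple a b c → rad a b c ≤ R → (R : ℝ) < ((rad a b c : ℕ) : ℝ) ^ Λ →
        (c : ℝ) ≤ ((rad a b c : ℕ) : ℝ) ^ (1 + δ)) :
    SparseGoodScales := by
  classical
  obtain ⟨θ', hθ'1, K, hK, R₀', h⟩ := hS
  have hsub := FeketeScalesAssembly.submult_normalise hK h
  set θ : ℝ := max θ' 0 with hθ_def
  set L : ℝ := max (Real.log K) 0 with hL_def
  set R₀ : ℕ := max R₀' 2 with hR₀_def
  have hθ0 : 0 ≤ θ := le_max_right _ _
  have hθ1 : θ < 1 := max_lt hθ'1 one_pos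
  have hL : 0 ≤ L := le_max_right _ _
  have hR₀2 : 2 ≤ R₀ := le_max_right _ _
  by_contra hneg
  -- unpack `¬ SGS`
  have hneg' : ∃ ε : ℝ, 0 < ε ∧ ∃ N₀ : ℕ, ∀ R : ℕ, N₀ ≤ R →
      ∃ a b c : ℕ, IsABCTriple a b c ∧ rad a b c ≤ R ∧ (R : ℝ) ^ (1 + ε) < c := by
    unfold SparseGoodScales at hneg
    push Not at hneg
    obtain ⟨ε, hε, N₀, hN₀⟩ := hneg
    exact ⟨ε, hε, N₀, fun R hR => hN₀ R hR⟩
  obtain ⟨ε, hε, N₀, hbad⟩ := hneg'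
  -- droughts for quality `1 + ε/2`
  obtain ⟨Λ, hΛ1, hdr⟩ := hD (ε / 2) (by linarith)
  have hΛpos : 0 < Λ := by linarith
  -- the small parameter `δ₁`
  have h4 : 0 < 4 * (Λ + 2) := by linarith
  set δ₁ : ℝ := min (ε / 12) ((Λ - 1) / (4 * (Λ + 2))) with hδ₁_def
  have hδ₁pos : 0 < δ₁ := lt_min (by linarith) (div_pos (by linarith) h4)
  have hδ₁ε : δ₁ ≤ ε / 12 := min_le_left _ _
  have hδ₁Λ : (Λ + 2) * δ₁ ≤ (Λ - 1) / 4 := by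
    have h1 : δ₁ ≤ (Λ - 1) / (4 * (Λ + 2)) := min_le_right _ _
    rw [le_div_iff₀ h4] at h1
    linarith
  obtain ⟨T, hT⟩ := upper_propagation hθ0 hθ1 hL hsub hδ₁pos
  set c₀ : ℝ := (Λ - 1) / 2 with hc₀_def
  have hc₀pos : 0 < c₀ := by rw [hc₀_def]; linarith
  -- STEP: an admissible pair produces an admissible pair one window up, with escalated exponent
  have step : ∀ (S : ℕ) (q : ℝ), R₀ ≤ S → T ≤ Real.log S → 0 ≤ q →
      (∀ a b c : ℕ, IsABCTriple a b c → rad a b c ≤ S → (c : ℝ) ≤ (S : ℝ) ^ q) →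
      ∃ (R : ℕ) (m₁ : ℝ), R₀ ≤ R ∧ T ≤ Real.log R ∧ 1 + ε < m₁ ∧
        q = Λ * m₁ - (Λ + 2) * δ₁ ∧
        (∀ a b c : ℕ, IsABCTriple a b c → rad a b c ≤ R → (c : ℝ) ≤ (R : ℝ) ^ m₁) := by
    intro S q hR₀S hTS hq0 hP
    have hS2 : 2 ≤ S := hR₀2.trans hR₀S
    obtain ⟨B, hB⟩ := hT S q hR₀S hS2 hTS hq0 hP
    -- choose a large drought scale `R`
    set N₁ : ℕ := max (max R₀ N₀) (max ⌈Real.exp T⌉₊ ⌈Real.exp (B / δ₁)⌉₊) with hN₁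
    obtain ⟨R, hN₁R, hR⟩ := hdr N₁
    have hR₀R : R₀ ≤ R := ((le_max_left _ _).trans (le_max_left _ _)).trans hN₁R
    have hN₀R : N₀ ≤ R := ((le_max_right _ _).trans (le_max_left _ _)).trans hN₁R
    have hRT : ⌈Real.exp T⌉₊ ≤ R := ((le_max_left _ _).trans (le_max_right _ _)).trans hN₁R
    have hRB : ⌈Real.exp (B / δ₁)⌉₊ ≤ R :=
      ((le_max_right _ _).trans (le_max_right _ _)).trans hN₁R
    have hR2 : 2 ≤ R := hR₀2.trans hR₀R
    have hR1' : (1:ℝ) < R := by exact_mod_cast hR2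
    have hR1 : (1:ℝ) ≤ R := hR1'.le
    have hRpos : (0:ℝ) < R := by positivity
    have hlogT : T ≤ Real.log R := by
      have h1 : Real.exp T ≤ R := (Nat.le_ceil _).trans (by exact_mod_cast hRT)
      have := Real.log_le_log (Real.exp_pos T) h1
      rwa [Real.log_exp] at this
    have hlogB : B / δ₁ ≤ Real.log R := by
      have h1 : Real.exp (B / δ₁) ≤ R := (Nat.le_ceil _).trans (by exact_mod_cast hRB)
      have := Real.log_le_log (Real.exp_pos _) h1
      rwa [Real.log_exp] at this
    -- `e^B ≤ R^{δ₁}`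
    have heB : Real.exp B ≤ (R : ℝ) ^ δ₁ := by
      rw [Real.rpow_def_of_pos hRpos]
      apply Real.exp_le_exp.2
      have h1 := mul_le_mul_of_nonneg_right hlogB hδ₁pos.le
      rw [div_mul_cancel₀ _ hδ₁pos.ne'] at h1
      linarith [mul_comm (Real.log R) δ₁]
    set m₁ : ℝ := (q + 2 * δ₁) / Λ + δ₁ with hm₁_def
    have hexp0 : 0 ≤ (q + 2 * δ₁) / Λ := div_nonneg (by linarith) hΛpos.le
    -- below the window: `c ≤ R^{m₁}`
    have hbelow : ∀ a b c : ℕ, IsABCTriple a b c → ((rad a b c : ℕ) : ℝ) ^ Λ ≤ R →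
        (c : ℝ) ≤ (R : ℝ) ^ m₁ := by
      intro a b c habc hle
      have hrad0 : (0:ℝ) ≤ ((rad a b c : ℕ) : ℝ) := Nat.cast_nonneg _
      have h1 : (c : ℝ) ≤ Real.exp B * ((rad a b c : ℕ) : ℝ) ^ (q + 2 * δ₁) := hB a b c habc
      have h2 : ((rad a b c : ℕ) : ℝ) ^ (q + 2 * δ₁) ≤ (R : ℝ) ^ ((q + 2 * δ₁) / Λ) := by
        have e : ((rad a b c : ℕ) : ℝ) ^ (q + 2 * δ₁) =
            (((rad a b c : ℕ) : ℝ) ^ Λ) ^ ((q + 2 * δ₁) / Λ) := by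
          rw [← Real.rpow_mul hrad0]
          congr 1
          field_simp
        rw [e]
        exact Real.rpow_le_rpow (Real.rpow_nonneg hrad0 _) hle hexp0
      have h3 : Real.exp B * ((rad a b c : ℕ) : ℝ) ^ (q + 2 * δ₁) ≤
          (R : ℝ) ^ δ₁ * (R : ℝ) ^ ((q + 2 * δ₁) / Λ) :=
        mul_le_mul heB h2 (Real.rpow_nonneg hrad0 _) (Real.rpow_nonneg hRpos.le _)
      have h4 : (R : ℝ) ^ δ₁ * (R : ℝ) ^ ((q + 2 * δ₁) / Λ) = (R : ℝ) ^ m₁ := by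
        rw [← Real.rpow_add hRpos, hm₁_def]
        congr 1; ring
      exact (h1.trans h3).trans h4.le
    -- flatness at the drought scale
    have hflat := flat_of_drought (δ := ε / 2) (Λ := Λ) (Y := (R : ℝ) ^ m₁) (R := R)
      (by linarith) hR hbelow
    set m : ℝ := max m₁ (1 + ε / 2) with hm_def
    have hPm : ∀ a b c : ℕ, IsABCTriple a b c → rad a b c ≤ R → (c : ℝ) ≤ (R : ℝ) ^ m := by
      intro a b c habc hrad
      refine (hflat a b c habc hrad).trans (max_le ?_ ?_)
      · exact Real.rpow_le_rpow_of_exponent_le hR1 (le_max_left _ _)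
      · exact Real.rpow_le_rpow_of_exponent_le hR1 (le_max_right _ _)
    -- `R ≥ N₀` is `ε`-bad, which forces the first branch of the max
    obtain ⟨a, b, c, habc, hrad, hlt⟩ := hbad R hN₀R
    have hcm : (c : ℝ) ≤ (R : ℝ) ^ m := hPm a b c habc hrad
    have hεm : 1 + ε < m := by
      have := hlt.trans_le hcm
      exact (Real.rpow_lt_rpow_left_iff hR1').1 this
    have hm₁ : 1 + ε < m₁ := by
      rcases lt_max_iff.1 hεm with h1 | h1
      · exact h1
      · linarith
    have hmm₁ : m = m₁ := max_eq_left (by linarith)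
    refine ⟨R, m₁, hR₀R, hlogT, hm₁, ?_, ?_⟩
    · rw [hm₁_def]; field_simp; ring
    · intro a b c habc hrad
      have := hPm a b c habc hrad
      rwa [hmm₁] at this
  -- ESCALATION: every admissible exponent is `≥ 1 + ε/2 + k c₀`, for every `k`
  have key : ∀ k : ℕ, ∀ (S : ℕ) (q : ℝ), R₀ ≤ S → T ≤ Real.log S → 0 ≤ q →
      (∀ a b c : ℕ, IsABCTriple a b c → rad a b c ≤ S → (c : ℝ) ≤ (S : ℝ) ^ q) →
      1 + ε / 2 + k * c₀ ≤ q := by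
    intro k
    induction k with
    | zero =>
      intro S q h1 h2 h3 h4
      obtain ⟨R, m₁, -, -, hm₁, hq, -⟩ := step S q h1 h2 h3 h4
      have hprod : Λ * (1 + ε) ≤ Λ * m₁ := mul_le_mul_of_nonneg_left hm₁.le hΛpos.le
      have hnn : 0 ≤ (Λ - 1) * (ε + 3 / 4) := mul_nonneg (by linarith) (by linarith)
      have e : Λ * (1 + ε) = (1 + ε) + (Λ - 1) * (ε + 3 / 4) + (Λ - 1) / 4 := by ring
      simp only [Nat.cast_zero, zero_mul, add_zero]
      linarith
    | succ k ih =>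
      intro S q h1 h2 h3 h4
      obtain ⟨R, m₁, hR₀R, hTR, hm₁, hq, hPR⟩ := step S q h1 h2 h3 h4
      have hm₁0 : 0 ≤ m₁ := by linarith
      have hIH := ih R m₁ hR₀R hTR hm₁0 hPR
      have hm₁1 : 1 ≤ m₁ := by linarith
      have hprod : (Λ - 1) * 1 ≤ (Λ - 1) * m₁ := mul_le_mul_of_nonneg_left hm₁1 (by linarith)
      have e : Λ * m₁ = m₁ + (Λ - 1) * m₁ := by ring
      push_cast
      rw [hq]
      linarith
  -- an admissible pair with a FIXED exponent, from abc.S25 (proved): contradiction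
  set Sstar : ℕ := max R₀ ⌈Real.exp T⌉₊ with hSstar
  have hR₀S : R₀ ≤ Sstar := le_max_left _ _
  have hS2 : 2 ≤ Sstar := hR₀2.trans hR₀S
  have hSpos : (0:ℝ) < Sstar := by positivity
  have hST : T ≤ Real.log Sstar := by
    have h1 : Real.exp T ≤ Sstar :=
      (Nat.le_ceil _).trans (by exact_mod_cast (le_max_right _ _ : ⌈Real.exp T⌉₊ ≤ Sstar))
    have := Real.log_le_log (Real.exp_pos T) h1
    rwa [Real.log_exp] at this
  obtain ⟨M, hM⟩ := feketeScales_exists_bound_of_rad_le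
    finite_setOf_isABCTriple_primeFactors_subset_holds Sstar
  have hPstar : ∀ a b c : ℕ, IsABCTriple a b c → rad a b c ≤ Sstar →
      (c : ℝ) ≤ (Sstar : ℝ) ^ (M : ℝ) := by
    intro a b c habc hrad
    have h1 : (c : ℝ) ≤ M := by exact_mod_cast hM a b c habc hrad
    have h2 : (M : ℝ) ≤ (2 : ℝ) ^ M := by exact_mod_cast (Nat.lt_two_pow_self).le
    have h3 : (2 : ℝ) ^ M ≤ (Sstar : ℝ) ^ M := pow_le_pow_left₀ (by norm_num) (by exact_mod_cast hS2) M
    rw [Real.rpow_natCast]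
    linarith
  obtain ⟨k, hk⟩ := exists_nat_gt ((M : ℝ) / c₀)
  have hkey := key k Sstar M hR₀S hST (Nat.cast_nonneg M) hPstar
  have hkc : (M : ℝ) < k * c₀ := by
    rw [div_lt_iff₀ hc₀pos] at hk
    linarith
  linarith

/-- **In-route logical position of DA∃**: under the rank-2 crux `ScaleSubmultiplicativity`,
DA∃ (droughts of some ratio) `↔ SparseGoodScales` (hence, with the landed
`sparseGoodScales_iff_abc_of_scaleSubmultiplicativity`, `↔ ABC ↔ WGS ↔ DA`). [folklore] -/
theorem droughtsOfSomeRatio_iff_sparseGoodScales_of_scaleSubmultiplicativity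
    (hS : ScaleSubmultiplicativity) :
    (∀ δ : ℝ, 0 < δ → ∃ Λ : ℝ, 1 < Λ ∧ ∀ N : ℕ, ∃ R : ℕ, N ≤ R ∧ ∀ a b c : ℕ,
      IsABCTriple a b c → rad a b c ≤ R → (R : ℝ) < ((rad a b c : ℕ) : ℝ) ^ Λ →
        (c : ℝ) ≤ ((rad a b c : ℕ) : ℝ) ^ (1 + δ)) ↔ SparseGoodScales :=
  ⟨sparseGoodScales_of_scaleSubmultiplicativity_of_droughts hS,
    droughtsOfSomeRatio_of_sparseGoodScales⟩

/-- **Calibration: `ABC → DA∃`** — every consequence drawn from the stub is consistent with abc,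
and no Negative lemma on it is possible short of `¬ABC` (via the landed `sparseGoodScales_of_abc`
and the thin-window implication `SGS → DA∃`). [folklore] -/
theorem droughtsOfSomeRatio_of_abc (habc : _root_.ABC) :
    ∀ δ : ℝ, 0 < δ → ∃ Λ : ℝ, 1 < Λ ∧ ∀ N : ℕ, ∃ R : ℕ, N ≤ R ∧ ∀ a b c : ℕ,
      IsABCTriple a b c → rad a b c ≤ R → (R : ℝ) < ((rad a b c : ℕ) : ℝ) ^ Λ →
        (c : ℝ) ≤ ((rad a b c : ℕ) : ℝ) ^ (1 + δ) :=
  droughtsOfSomeRatio_of_sparseGoodScales (sparseGoodScales_of_abc habc)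

/-- **In-route the stub is the summit**: under `ScaleSubmultiplicativity`, DA∃ `↔ ABC`
(compose `droughtsOfSomeRatio_iff_sparseGoodScales_of_scaleSubmultiplicativity` with the landed
`sparseGoodScales_iff_abc_of_scaleSubmultiplicativity`). [folklore] -/
theorem droughtsOfSomeRatio_iff_abc_of_scaleSubmultiplicativity (hS : ScaleSubmultiplicativity) :
    (∀ δ : ℝ, 0 < δ → ∃ Λ : ℝ, 1 < Λ ∧ ∀ N : ℕ, ∃ R : ℕ, N ≤ R ∧ ∀ a b c : ℕ,
      IsABCTriple a b c → rad a b c ≤ R → (R : ℝ) < ((rad a b c : ℕ) : ℝ) ^ Λ →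
        (c : ℝ) ≤ ((rad a b c : ℕ) : ℝ) ^ (1 + δ)) ↔ _root_.ABC :=
  (droughtsOfSomeRatio_iff_sparseGoodScales_of_scaleSubmultiplicativity hS).trans
    (sparseGoodScales_iff_abc_of_scaleSubmultiplicativity hS)

/-- **The composition of line `SketchIdeator4`, registered form** (the sub-goal of stmt-ABC-2161
this file serves, on one line: `ScaleSubmultiplicativity → DA∃ → SparseGoodScales`; it is the
signature registered on the item).  This is `sparseGoodScales_of_scaleSubmultiplicativity_of_droughts`.
[folklore] -/
theorem sparseGoodScales_of_submult_of_droughtsOfSomeRatio : Summit.ABC.ABC.Theses.FeketeScales.ScaleSubmultiplicativity → (∀ δ : ℝ, 0 < δ → ∃ Λ : ℝ, 1 < Λ ∧ ∀ N : ℕ, ∃ R : ℕ, N ≤ R ∧ ∀ a b c : ℕ, IsABCTriple a b c → rad a b c ≤ R → (R : ℝ) < ((rad a b c : ℕ) : ℝ) ^ Λ → (c : ℝ) ≤ ((rad a b c : ℕ) : ℝ) ^ (1 + δ)) → Summit.ABC.ABC.Theses.FeketeScales.SparseGoodScales :=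
  fun hS hD => sparseGoodScales_of_scaleSubmultiplicativity_of_droughts hS hD

end Summit.ABC.ABC.Theorems.SparseGoodScales
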